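import Summits.BirchSwinnertonDyer.BirchSwinnertonDyer.Theorems.ByReductionTypeAtTwoFineSelmerConjAAtTwoAdditivePotGoodNarrowRankCertificate316LayerOneTotPos
import HarnessLib

/-!
# Route `ByReductionTypeAtTwo` (rung K4), crux C1″ `FineSelmerConjAAtTwoAdditivePotGood` (item stmt-BirchSwinnertonDyer-22615):
# THE LAYER-`1` FIELD `A₁ = ℚ(θ, √2)` OF THE CUBIC FIELD OF DISCRIMINANT `316`, PART E — the UNIT SIGNATURE certificate:
# `#(U⁺/U²)(A₁) = 2` and `[Cl⁺(A₁) : Cl⁺(A₁)²] = 2` (`rank₂ Cl⁺(ℚ(θ,√2)) = 1`), KERNEL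
# (a `--supports 22615` file; seat `bsd-2adic-k4-w1` GEN 11; sequel of `…316LayerOneTotPos`; row `261648q1`, narrow-rank certificate one layer up)

HONEST FRAMING (cell `bsd-2adic`, D-0036/D-0054/D-0152): KERNEL theorems about ONE totally real sextic field; no elliptic curve, no named fact,
no `sorry`, no definition. Closes nothing at the `∀`-level; nothing booked; BSD is not proved by any of this.

THE CERTIFICATE.  Real places of `A₁`: `σ = (r_i, ±√2)`, `r₀ ≈ −1.81361 < r₁ ≈ 0.47068 < r₂ ≈ 2.34292` the roots of `X³ − X² − 4X + 2`
(located to `10⁻¹⁰`, `…316Cubic`), `√2` located to `10⁻¹⁰`.  Units (`b = θ`, `ξ = √2/θ = √2(4 + θ − θ²)/2`): `e₁ = 1 + √2`, `e₂ = 4 − θ² − ξ`,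
`e₃ = −θ − ξ + 2√2`, `e₄ = θ − ξ + 2√2` (the tiny fundamental units of eng-2's `narrow-6` table, re-found by the seat's exact search and verified
here by their inverses) have, with `−1`, an invertible `5 × 5` sign matrix at the places `(r₀,+), (r₀,−), (r₁,−), (r₂,+), (r₂,−)` ⟹ `#sign(U) ≥ 32`;
`#(U⁺/U²) ≥ 2` by the totally positive non-square `u₊` (`…316LayerOneTotPos`); with `[A₁ : ℚ] = 6` this is
`#(U⁺/U²)(A₁) = 2`, and `h(A₁)` odd (`…316LayerOneDyadic`) gives `[Cl⁺(A₁) : Cl⁺(A₁)²] = 2` (tree `index_range_pow_two_narrowClassGroup_eq_card_…`, N1).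
Every sign is decided by LINEAR arithmetic from interval bounds on the monomials `|x|, x², √2, √2|x|, √2x²` (`mul_bounds`), the value of a unit at
`σ` being an explicit polynomial in `x = σ(θ)`, `y = σ(√2)` (`σ(ξ) = y(4 + x − x²)/2`, reduced with `x³ = x² + 4x − 2`, `y² = 2`).  Matches eng-2's CERT-NARROW6 (`h⁺(K(√2)) = 2`) and
k4-w2's exact census (ρ(K(√2)) = 1); here KERNEL.

* `layer_one_unit_ids_d316` — the inverses of `e₁ … e₄` (any commutative ring).
* **`card_totPosUnitsModSq_adjoin_sup_layer_one_d316`** (`= 2`), **`index_range_pow_two_narrowClassGroup_adjoin_sup_layer_one_d316`** (`= 2`).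

References: [FrohlichTaylor1990] Ch. V §1 (1.8)–(1.13); [Cohen1993] §4.1.3, §6.3; [Washington1997] §13.1.
-/

set_option autoImplicit false
-- sibling precedent: the directory name repeats the summit name
set_option linter.dupNamespace false

noncomputable section

open scoped Classical IntermediateField NumberField

namespace Summit.BirchSwinnertonDyer.BirchSwinnertonDyer.Theorems.AddKatoTwo

open Polynomial IsDedekindDomain NumberField Field IntermediateField
  Literature.NumberTheory.EllipticCurves Literature.NumberTheory.EllipticCurves.ZpExtension
  Literature.NumberTheory.IwasawaTheory Literature.NumberTheory.NumberFields
  Literature.NumberTheory.GaloisRepresentations Literature.Geometry.Kaehler.ComplexTorus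

/-- **The inverses of the units `e₁ = 1 + bξ`, `e₂ = 4 − b² − ξ`, `e₃ = −b − ξ + 2bξ`, `e₄ = b − ξ + 2bξ` of `ℤ[θ, ξ]`** (`θ³ − θ² − 4θ + 2 = 0`,
`ξ² = 9 + θ − 2θ²`), in any commutative ring. [folklore] [cite: Cohen1993, §6.3] -/
theorem layer_one_unit_ids_d316 {R : Type*} [CommRing R] (b x : R) (Rb : b ^ 3 - b ^ 2 - 4 * b + 2 = 0)
    (Rx : x ^ 2 = 9 + b - 2 * b ^ 2) :
    (1 + b * x) * (-1 + b * x) = 1 ∧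
    (4 - b ^ 2 - x) * (-x + 2 * b + 3 * b * x - b ^ 2 - b ^ 2 * x) = 1 ∧
    (-b - x + 2 * b * x) * (-2 + x - b - b * x - b ^ 2 * x) = 1 ∧
    (b - x + 2 * b * x) * (2 + x + b - b * x - b ^ 2 * x) = 1 := by
  refine ⟨?_, ?_, ?_, ?_⟩
  · linear_combination ((-1 : R) + (-2 : R) * b) * Rb + ((1 : R) * b ^ 2) * Rx
  · linear_combination ((4 : R) + (-2 : R) * x + (-1 : R) * b + (1 : R) * b * x) * Rb + ((1 : R) + (-3 : R) * b + (1 : R) * b ^ 2) * Rx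
  · linear_combination ((13 : R) + (1 : R) * x + (6 : R) * b + (-2 : R) * x ^ 2) * Rb + ((3 : R) + (-5 : R) * b + (-3 : R) * b ^ 2) * Rx
  · linear_combination ((13 : R) + (-1 : R) * x + (6 : R) * b + (-2 : R) * x ^ 2) * Rb + ((3 : R) + (-5 : R) * b + (-3 : R) * b ^ 2) * Rx

variable {θ : AlgebraicClosure ℚ}

set_option linter.unusedSimpArgs false in
set_option maxHeartbeats 1600000 in
/-- **`#(U⁺/U²)(ℚ(θ) ⊔ ℚ_1) = 2` for `θ³ − θ² − 4θ + 2 = 0`** (`ℚ(θ, √2)`, totally real sextic, narrow defect `1`), KERNEL — five units with an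
invertible sign matrix at five real embeddings (`#sign(U) ≥ 32`), and `#(U⁺/U²) ≥ 2` from `…316LayerOneTotPos`.
[cite: FrohlichTaylor1990, Ch. V §1 (1.12)–(1.13), p. 164] [cite: Cohen1993, §4.1.3] [cite: Washington1997, §13.1] -/
theorem card_totPosUnitsModSq_adjoin_sup_layer_one_d316
    (hθ : aeval θ (Cubic.toPoly ⟨1, ((-1 : ℤ) : ℚ), ((-4 : ℤ) : ℚ), ((2 : ℤ) : ℚ)⟩) = 0) :
    haveI : FiniteDimensional ℚ ↥ℚ⟮θ⟯ :=
      IntermediateField.adjoin.finiteDimensional ⟨_, Cubic.monic_of_a_eq_one', by rwa [← aeval_def]⟩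
    haveI : FiniteDimensional ℚ ↥((CyclotomicZp.zpExtension 2).layer 1) := (CyclotomicZp.zpExtension 2).finiteDimensional_layer_holds 1
    haveI : NumberField ↥(ℚ⟮θ⟯ ⊔ (CyclotomicZp.zpExtension 2).layer 1) := NumberField.mk
    Nat.card (TotPosUnitsModSq ↥(ℚ⟮θ⟯ ⊔ (CyclotomicZp.zpExtension 2).layer 1)) = 2 := by
  haveI : FiniteDimensional ℚ ↥ℚ⟮θ⟯ :=
    IntermediateField.adjoin.finiteDimensional ⟨_, Cubic.monic_of_a_eq_one', by rwa [← aeval_def]⟩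
  haveI : FiniteDimensional ℚ ↥((CyclotomicZp.zpExtension 2).layer 1) := (CyclotomicZp.zpExtension 2).finiteDimensional_layer_holds 1
  haveI : NumberField ↥ℚ⟮θ⟯ := NumberField.mk
  haveI : NumberField ↥(ℚ⟮θ⟯ ⊔ (CyclotomicZp.zpExtension 2).layer 1) := NumberField.mk
  obtain ⟨hreal, hfinA, h3⟩ := layer_one_basics_d316 hθ
  haveI := hreal
  obtain ⟨t, ht, ht2⟩ := CyclotomicZp.exists_mem_layer_one_sq_eq_two_zpExtension
  have hKA : ℚ⟮θ⟯ ≤ ℚ⟮θ⟯ ⊔ (CyclotomicZp.zpExtension 2).layer 1 := le_sup_left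
  have htA : t ∈ ℚ⟮θ⟯ ⊔ (CyclotomicZp.zpExtension 2).layer 1 := (le_sup_right : (CyclotomicZp.zpExtension 2).layer 1 ≤ _) ht
  set t' : ↥(ℚ⟮θ⟯ ⊔ (CyclotomicZp.zpExtension 2).layer 1) := ⟨t, htA⟩ with ht'def
  set θ' : ↥(ℚ⟮θ⟯ ⊔ (CyclotomicZp.zpExtension 2).layer 1) := inclusion hKA (AdjoinSimple.gen ℚ θ) with hθ'def
  -- layer-0 embeddings and `√2`
  obtain ⟨ρ₀, ρ₁, ρ₂, x₀, x₁, x₂, hρ₀, hρ₁, hρ₂, hl₀, hu₀, hl₁, hu₁, hl₂, hu₂⟩ := exists_three_ringHom_adjoin_d316 hθ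
  have hs2l : ((14142135623 : ℝ) / 10000000000) < Real.sqrt 2 :=
    (Real.lt_sqrt (by norm_num)).mpr (by norm_num)
  have hs2u : Real.sqrt 2 < ((14142135624 : ℝ) / 10000000000) :=
    (Real.sqrt_lt' (by norm_num)).mpr (by norm_num)
  -- the integers of `…316LayerOneDyadic`
  obtain ⟨bA, xA, -, -, hbAval, -, hxθ, RbA, RxA, -, -, -, -, -, -, -, -, -, -⟩ := layer_one_dyadic_d316 hθ ht ht2
  have hθ'rel : θ' ^ 3 - θ' ^ 2 - 4 * θ' + 2 = 0 := by
    have h := congrArg (algebraMap (𝓞 ↥(ℚ⟮θ⟯ ⊔ (CyclotomicZp.zpExtension 2).layer 1)) ↥(ℚ⟮θ⟯ ⊔ (CyclotomicZp.zpExtension 2).layer 1)) RbA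
    simp only [map_add, map_sub, map_mul, map_pow, map_ofNat, map_zero] at h
    rw [← NumberField.RingOfIntegers.coe_eq_algebraMap, hbAval] at h; exact h
  -- values under an embedding `σ` with `σ θ' = x`, `σ t' = y`: `σ(b) = x`, `σ(ξ) = y(4 + x − x²)/2`
  have hval : ∀ (σ : ↥(ℚ⟮θ⟯ ⊔ (CyclotomicZp.zpExtension 2).layer 1) →+* ℝ) (x y : ℝ), σ θ' = x → σ t' = y →
      σ (algebraMap (𝓞 ↥(ℚ⟮θ⟯ ⊔ (CyclotomicZp.zpExtension 2).layer 1)) ↥(ℚ⟮θ⟯ ⊔ (CyclotomicZp.zpExtension 2).layer 1) bA) = x ∧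
      σ (algebraMap (𝓞 ↥(ℚ⟮θ⟯ ⊔ (CyclotomicZp.zpExtension 2).layer 1)) ↥(ℚ⟮θ⟯ ⊔ (CyclotomicZp.zpExtension 2).layer 1) xA) =
        y * (4 + x - x ^ 2) / 2 ∧ x ^ 3 - x ^ 2 - 4 * x + 2 = 0 := by
    intro σ x y hx hy
    have hb : σ (algebraMap _ _ bA) = x := by rw [← NumberField.RingOfIntegers.coe_eq_algebraMap, hbAval, hx]
    have hxrel : x ^ 3 - x ^ 2 - 4 * x + 2 = 0 := by
      have h := congrArg σ hθ'rel
      simp only [map_add, map_sub, map_mul, map_pow, map_ofNat, map_zero, hx] at h; exact h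
    refine ⟨hb, ?_, hxrel⟩
    have h1 : σ (algebraMap _ _ xA) * x = y := by
      rw [← hx, ← map_mul, ← NumberField.RingOfIntegers.coe_eq_algebraMap, hxθ]; exact hy
    have h2 : x * (4 + x - x ^ 2) = 2 := by linear_combination (-1 : ℝ) * hxrel
    calc σ (algebraMap _ _ xA) = σ (algebraMap _ _ xA) * (x * (4 + x - x ^ 2)) / 2 := by rw [h2]; ring
      _ = (σ (algebraMap _ _ xA) * x) * (4 + x - x ^ 2) / 2 := by ring
      _ = y * (4 + x - x ^ 2) / 2 := by rw [h1]
  -- the units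
  obtain ⟨hid₁, hid₂, hid₃, hid₄⟩ := layer_one_unit_ids_d316 bA xA RbA RxA
  set e₀ : (𝓞 ↥(ℚ⟮θ⟯ ⊔ (CyclotomicZp.zpExtension 2).layer 1))ˣ := -1 with he₀def
  set e₁ : (𝓞 ↥(ℚ⟮θ⟯ ⊔ (CyclotomicZp.zpExtension 2).layer 1))ˣ := Units.mkOfMulEqOne _ _ hid₁ with he₁def
  set e₂ : (𝓞 ↥(ℚ⟮θ⟯ ⊔ (CyclotomicZp.zpExtension 2).layer 1))ˣ := Units.mkOfMulEqOne _ _ hid₂ with he₂def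
  set e₃ : (𝓞 ↥(ℚ⟮θ⟯ ⊔ (CyclotomicZp.zpExtension 2).layer 1))ˣ := Units.mkOfMulEqOne _ _ hid₃ with he₃def
  set e₄ : (𝓞 ↥(ℚ⟮θ⟯ ⊔ (CyclotomicZp.zpExtension 2).layer 1))ˣ := Units.mkOfMulEqOne _ _ hid₄ with he₄def
  have sneg : ∀ (σ : ↥(ℚ⟮θ⟯ ⊔ (CyclotomicZp.zpExtension 2).layer 1) →+* ℝ) (e : (𝓞 ↥(ℚ⟮θ⟯ ⊔ (CyclotomicZp.zpExtension 2).layer 1))ˣ),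
      σ ((e : 𝓞 ↥(ℚ⟮θ⟯ ⊔ (CyclotomicZp.zpExtension 2).layer 1)) : ↥(ℚ⟮θ⟯ ⊔ (CyclotomicZp.zpExtension 2).layer 1)) < 0 → signVec e σ = 1 :=
    fun σ e h => by rw [signVec_apply, if_pos h]
  have spos : ∀ (σ : ↥(ℚ⟮θ⟯ ⊔ (CyclotomicZp.zpExtension 2).layer 1) →+* ℝ) (e : (𝓞 ↥(ℚ⟮θ⟯ ⊔ (CyclotomicZp.zpExtension 2).layer 1))ˣ),
      0 < σ ((e : 𝓞 ↥(ℚ⟮θ⟯ ⊔ (CyclotomicZp.zpExtension 2).layer 1)) : ↥(ℚ⟮θ⟯ ⊔ (CyclotomicZp.zpExtension 2).layer 1)) → signVec e σ = 0 :=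
    fun σ e h => by rw [signVec_apply, if_neg (not_lt.mpr h.le)]
  -- place σ₁: θ ↦ x₀, √2 ↦ +√2
  obtain ⟨σ₁, hσ₁K, hσ₁t⟩ := exists_ringHom_sup_layer_one_d316 hθ ht ht2 ρ₀ (Real.sqrt 2) (Or.inl rfl)
  have hσ₁θ : σ₁ θ' = x₀ := by rw [hθ'def, hσ₁K, hρ₀]
  obtain ⟨hσ₁b, hσ₁x, hσ₁r⟩ := hval σ₁ x₀ (Real.sqrt 2) hσ₁θ hσ₁t
  have hysqσ₁ : (Real.sqrt 2) ^ 2 = 2 := by exact Real.sq_sqrt (by norm_num)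
  -- place σ₂: θ ↦ x₀, √2 ↦ −√2
  obtain ⟨σ₂, hσ₂K, hσ₂t⟩ := exists_ringHom_sup_layer_one_d316 hθ ht ht2 ρ₀ (-Real.sqrt 2) (Or.inr rfl)
  have hσ₂θ : σ₂ θ' = x₀ := by rw [hθ'def, hσ₂K, hρ₀]
  obtain ⟨hσ₂b, hσ₂x, hσ₂r⟩ := hval σ₂ x₀ (-Real.sqrt 2) hσ₂θ hσ₂t
  have hysqσ₂ : (-Real.sqrt 2) ^ 2 = 2 := by rw [neg_sq]; exact Real.sq_sqrt (by norm_num)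
  -- place σ₄: θ ↦ x₁, √2 ↦ −√2
  obtain ⟨σ₄, hσ₄K, hσ₄t⟩ := exists_ringHom_sup_layer_one_d316 hθ ht ht2 ρ₁ (-Real.sqrt 2) (Or.inr rfl)
  have hσ₄θ : σ₄ θ' = x₁ := by rw [hθ'def, hσ₄K, hρ₁]
  obtain ⟨hσ₄b, hσ₄x, hσ₄r⟩ := hval σ₄ x₁ (-Real.sqrt 2) hσ₄θ hσ₄t
  have hysqσ₄ : (-Real.sqrt 2) ^ 2 = 2 := by rw [neg_sq]; exact Real.sq_sqrt (by norm_num)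
  -- place σ₅: θ ↦ x₂, √2 ↦ +√2
  obtain ⟨σ₅, hσ₅K, hσ₅t⟩ := exists_ringHom_sup_layer_one_d316 hθ ht ht2 ρ₂ (Real.sqrt 2) (Or.inl rfl)
  have hσ₅θ : σ₅ θ' = x₂ := by rw [hθ'def, hσ₅K, hρ₂]
  obtain ⟨hσ₅b, hσ₅x, hσ₅r⟩ := hval σ₅ x₂ (Real.sqrt 2) hσ₅θ hσ₅t
  have hysqσ₅ : (Real.sqrt 2) ^ 2 = 2 := by exact Real.sq_sqrt (by norm_num)
  -- place σ₆: θ ↦ x₂, √2 ↦ −√2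
  obtain ⟨σ₆, hσ₆K, hσ₆t⟩ := exists_ringHom_sup_layer_one_d316 hθ ht ht2 ρ₂ (-Real.sqrt 2) (Or.inr rfl)
  have hσ₆θ : σ₆ θ' = x₂ := by rw [hθ'def, hσ₆K, hρ₂]
  obtain ⟨hσ₆b, hσ₆x, hσ₆r⟩ := hval σ₆ x₂ (-Real.sqrt 2) hσ₆θ hσ₆t
  have hysqσ₆ : (-Real.sqrt 2) ^ 2 = 2 := by rw [neg_sq]; exact Real.sq_sqrt (by norm_num)
  have hXl₀ : ((9068032513 : ℝ) / 5000000000) < -x₀ := by linarith [hu₀]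
  have hXu₀ : -x₀ < ((18136065027 : ℝ) / 10000000000) := by linarith [hl₀]
  obtain ⟨hXXl₀, hXXu₀⟩ := Ioo_mul_bounds (by norm_num) (by norm_num) hXl₀ hXu₀ hXl₀ hXu₀
  obtain ⟨hYXl₀, hYXu₀⟩ := Ioo_mul_bounds (by norm_num) (by norm_num) hs2l hs2u hXl₀ hXu₀
  obtain ⟨hYXXl₀, hYXXu₀⟩ := Ioo_mul_bounds (by norm_num) (by norm_num) hs2l hs2u hXXl₀ hXXu₀
  obtain ⟨hXXl₁, hXXu₁⟩ := Ioo_mul_bounds (by norm_num) (by norm_num) hl₁ hu₁ hl₁ hu₁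
  obtain ⟨hYXl₁, hYXu₁⟩ := Ioo_mul_bounds (by norm_num) (by norm_num) hs2l hs2u hl₁ hu₁
  obtain ⟨hYXXl₁, hYXXu₁⟩ := Ioo_mul_bounds (by norm_num) (by norm_num) hs2l hs2u hXXl₁ hXXu₁
  obtain ⟨hXXl₂, hXXu₂⟩ := Ioo_mul_bounds (by norm_num) (by norm_num) hl₂ hu₂ hl₂ hu₂
  obtain ⟨hYXl₂, hYXu₂⟩ := Ioo_mul_bounds (by norm_num) (by norm_num) hs2l hs2u hl₂ hu₂
  obtain ⟨hYXXl₂, hYXXu₂⟩ := Ioo_mul_bounds (by norm_num) (by norm_num) hs2l hs2u hXXl₂ hXXu₂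
  have se₁σ₁ : 0 < σ₁ ((e₁ : 𝓞 ↥(ℚ⟮θ⟯ ⊔ (CyclotomicZp.zpExtension 2).layer 1)) : ↥(ℚ⟮θ⟯ ⊔ (CyclotomicZp.zpExtension 2).layer 1)) := by
    have hv : σ₁ ((e₁ : 𝓞 ↥(ℚ⟮θ⟯ ⊔ (CyclotomicZp.zpExtension 2).layer 1)) : ↥(ℚ⟮θ⟯ ⊔ (CyclotomicZp.zpExtension 2).layer 1)) = (1 : ℝ) + (1 : ℝ) * Real.sqrt 2 := by
      rw [he₁def, Units.val_mkOfMulEqOne, NumberField.RingOfIntegers.coe_eq_algebraMap]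
      simp only [map_add, map_sub, map_mul, map_pow, map_neg, map_one, map_ofNat, hσ₁b, hσ₁x]
      linear_combination (((-1 : ℝ) / 2) * (Real.sqrt 2)) * hσ₁r + ((0 : ℝ)) * hysqσ₁
    rw [hv]; linarith [hXXl₀, hXXu₀, hYXl₀, hYXu₀, hYXXl₀, hYXXu₀, hs2l, hs2u, hXl₀, hXu₀]
  have se₁σ₂ : σ₂ ((e₁ : 𝓞 ↥(ℚ⟮θ⟯ ⊔ (CyclotomicZp.zpExtension 2).layer 1)) : ↥(ℚ⟮θ⟯ ⊔ (CyclotomicZp.zpExtension 2).layer 1)) < 0 := by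
    have hv : σ₂ ((e₁ : 𝓞 ↥(ℚ⟮θ⟯ ⊔ (CyclotomicZp.zpExtension 2).layer 1)) : ↥(ℚ⟮θ⟯ ⊔ (CyclotomicZp.zpExtension 2).layer 1)) = (1 : ℝ) + (-1 : ℝ) * Real.sqrt 2 := by
      rw [he₁def, Units.val_mkOfMulEqOne, NumberField.RingOfIntegers.coe_eq_algebraMap]
      simp only [map_add, map_sub, map_mul, map_pow, map_neg, map_one, map_ofNat, hσ₂b, hσ₂x]
      linear_combination (((-1 : ℝ) / 2) * (-Real.sqrt 2)) * hσ₂r + ((0 : ℝ)) * hysqσ₂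
    rw [hv]; linarith [hXXl₀, hXXu₀, hYXl₀, hYXu₀, hYXXl₀, hYXXu₀, hs2l, hs2u, hXl₀, hXu₀]
  have se₁σ₄ : σ₄ ((e₁ : 𝓞 ↥(ℚ⟮θ⟯ ⊔ (CyclotomicZp.zpExtension 2).layer 1)) : ↥(ℚ⟮θ⟯ ⊔ (CyclotomicZp.zpExtension 2).layer 1)) < 0 := by
    have hv : σ₄ ((e₁ : 𝓞 ↥(ℚ⟮θ⟯ ⊔ (CyclotomicZp.zpExtension 2).layer 1)) : ↥(ℚ⟮θ⟯ ⊔ (CyclotomicZp.zpExtension 2).layer 1)) = (1 : ℝ) + (-1 : ℝ) * Real.sqrt 2 := by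
      rw [he₁def, Units.val_mkOfMulEqOne, NumberField.RingOfIntegers.coe_eq_algebraMap]
      simp only [map_add, map_sub, map_mul, map_pow, map_neg, map_one, map_ofNat, hσ₄b, hσ₄x]
      linear_combination (((-1 : ℝ) / 2) * (-Real.sqrt 2)) * hσ₄r + ((0 : ℝ)) * hysqσ₄
    rw [hv]; linarith [hXXl₁, hXXu₁, hYXl₁, hYXu₁, hYXXl₁, hYXXu₁, hs2l, hs2u, hl₁, hu₁]
  have se₁σ₅ : 0 < σ₅ ((e₁ : 𝓞 ↥(ℚ⟮θ⟯ ⊔ (CyclotomicZp.zpExtension 2).layer 1)) : ↥(ℚ⟮θ⟯ ⊔ (CyclotomicZp.zpExtension 2).layer 1)) := by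
    have hv : σ₅ ((e₁ : 𝓞 ↥(ℚ⟮θ⟯ ⊔ (CyclotomicZp.zpExtension 2).layer 1)) : ↥(ℚ⟮θ⟯ ⊔ (CyclotomicZp.zpExtension 2).layer 1)) = (1 : ℝ) + (1 : ℝ) * Real.sqrt 2 := by
      rw [he₁def, Units.val_mkOfMulEqOne, NumberField.RingOfIntegers.coe_eq_algebraMap]
      simp only [map_add, map_sub, map_mul, map_pow, map_neg, map_one, map_ofNat, hσ₅b, hσ₅x]
      linear_combination (((-1 : ℝ) / 2) * (Real.sqrt 2)) * hσ₅r + ((0 : ℝ)) * hysqσ₅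
    rw [hv]; linarith [hXXl₂, hXXu₂, hYXl₂, hYXu₂, hYXXl₂, hYXXu₂, hs2l, hs2u, hl₂, hu₂]
  have se₁σ₆ : σ₆ ((e₁ : 𝓞 ↥(ℚ⟮θ⟯ ⊔ (CyclotomicZp.zpExtension 2).layer 1)) : ↥(ℚ⟮θ⟯ ⊔ (CyclotomicZp.zpExtension 2).layer 1)) < 0 := by
    have hv : σ₆ ((e₁ : 𝓞 ↥(ℚ⟮θ⟯ ⊔ (CyclotomicZp.zpExtension 2).layer 1)) : ↥(ℚ⟮θ⟯ ⊔ (CyclotomicZp.zpExtension 2).layer 1)) = (1 : ℝ) + (-1 : ℝ) * Real.sqrt 2 := by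
      rw [he₁def, Units.val_mkOfMulEqOne, NumberField.RingOfIntegers.coe_eq_algebraMap]
      simp only [map_add, map_sub, map_mul, map_pow, map_neg, map_one, map_ofNat, hσ₆b, hσ₆x]
      linear_combination (((-1 : ℝ) / 2) * (-Real.sqrt 2)) * hσ₆r + ((0 : ℝ)) * hysqσ₆
    rw [hv]; linarith [hXXl₂, hXXu₂, hYXl₂, hYXu₂, hYXXl₂, hYXXu₂, hs2l, hs2u, hl₂, hu₂]
  have se₂σ₁ : 0 < σ₁ ((e₂ : 𝓞 ↥(ℚ⟮θ⟯ ⊔ (CyclotomicZp.zpExtension 2).layer 1)) : ↥(ℚ⟮θ⟯ ⊔ (CyclotomicZp.zpExtension 2).layer 1)) := by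
    have hv : σ₁ ((e₂ : 𝓞 ↥(ℚ⟮θ⟯ ⊔ (CyclotomicZp.zpExtension 2).layer 1)) : ↥(ℚ⟮θ⟯ ⊔ (CyclotomicZp.zpExtension 2).layer 1)) = (4 : ℝ) + (-2 : ℝ) * Real.sqrt 2 + ((1 : ℝ) / 2) * (Real.sqrt 2 * (-x₀)) + (-1 : ℝ) * ((-x₀) * (-x₀)) + ((1 : ℝ) / 2) * (Real.sqrt 2 * ((-x₀) * (-x₀))) := by
      rw [he₂def, Units.val_mkOfMulEqOne, NumberField.RingOfIntegers.coe_eq_algebraMap]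
      simp only [map_add, map_sub, map_mul, map_pow, map_neg, map_one, map_ofNat, hσ₁b, hσ₁x]
      linear_combination ((0 : ℝ)) * hσ₁r + ((0 : ℝ)) * hysqσ₁
    rw [hv]; linarith [hXXl₀, hXXu₀, hYXl₀, hYXu₀, hYXXl₀, hYXXu₀, hs2l, hs2u, hXl₀, hXu₀]
  have se₂σ₂ : σ₂ ((e₂ : 𝓞 ↥(ℚ⟮θ⟯ ⊔ (CyclotomicZp.zpExtension 2).layer 1)) : ↥(ℚ⟮θ⟯ ⊔ (CyclotomicZp.zpExtension 2).layer 1)) < 0 := by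
    have hv : σ₂ ((e₂ : 𝓞 ↥(ℚ⟮θ⟯ ⊔ (CyclotomicZp.zpExtension 2).layer 1)) : ↥(ℚ⟮θ⟯ ⊔ (CyclotomicZp.zpExtension 2).layer 1)) = (4 : ℝ) + (2 : ℝ) * Real.sqrt 2 + ((-1 : ℝ) / 2) * (Real.sqrt 2 * (-x₀)) + (-1 : ℝ) * ((-x₀) * (-x₀)) + ((-1 : ℝ) / 2) * (Real.sqrt 2 * ((-x₀) * (-x₀))) := by
      rw [he₂def, Units.val_mkOfMulEqOne, NumberField.RingOfIntegers.coe_eq_algebraMap]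
      simp only [map_add, map_sub, map_mul, map_pow, map_neg, map_one, map_ofNat, hσ₂b, hσ₂x]
      linear_combination ((0 : ℝ)) * hσ₂r + ((0 : ℝ)) * hysqσ₂
    rw [hv]; linarith [hXXl₀, hXXu₀, hYXl₀, hYXu₀, hYXXl₀, hYXXu₀, hs2l, hs2u, hXl₀, hXu₀]
  have se₂σ₄ : 0 < σ₄ ((e₂ : 𝓞 ↥(ℚ⟮θ⟯ ⊔ (CyclotomicZp.zpExtension 2).layer 1)) : ↥(ℚ⟮θ⟯ ⊔ (CyclotomicZp.zpExtension 2).layer 1)) := by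
    have hv : σ₄ ((e₂ : 𝓞 ↥(ℚ⟮θ⟯ ⊔ (CyclotomicZp.zpExtension 2).layer 1)) : ↥(ℚ⟮θ⟯ ⊔ (CyclotomicZp.zpExtension 2).layer 1)) = (4 : ℝ) + (2 : ℝ) * Real.sqrt 2 + ((1 : ℝ) / 2) * (Real.sqrt 2 * x₁) + (-1 : ℝ) * (x₁ * x₁) + ((-1 : ℝ) / 2) * (Real.sqrt 2 * (x₁ * x₁)) := by
      rw [he₂def, Units.val_mkOfMulEqOne, NumberField.RingOfIntegers.coe_eq_algebraMap]
      simp only [map_add, map_sub, map_mul, map_pow, map_neg, map_one, map_ofNat, hσ₄b, hσ₄x]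
      linear_combination ((0 : ℝ)) * hσ₄r + ((0 : ℝ)) * hysqσ₄
    rw [hv]; linarith [hXXl₁, hXXu₁, hYXl₁, hYXu₁, hYXXl₁, hYXXu₁, hs2l, hs2u, hl₁, hu₁]
  have se₂σ₅ : σ₅ ((e₂ : 𝓞 ↥(ℚ⟮θ⟯ ⊔ (CyclotomicZp.zpExtension 2).layer 1)) : ↥(ℚ⟮θ⟯ ⊔ (CyclotomicZp.zpExtension 2).layer 1)) < 0 := by
    have hv : σ₅ ((e₂ : 𝓞 ↥(ℚ⟮θ⟯ ⊔ (CyclotomicZp.zpExtension 2).layer 1)) : ↥(ℚ⟮θ⟯ ⊔ (CyclotomicZp.zpExtension 2).layer 1)) = (4 : ℝ) + (-2 : ℝ) * Real.sqrt 2 + ((-1 : ℝ) / 2) * (Real.sqrt 2 * x₂) + (-1 : ℝ) * (x₂ * x₂) + ((1 : ℝ) / 2) * (Real.sqrt 2 * (x₂ * x₂)) := by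
      rw [he₂def, Units.val_mkOfMulEqOne, NumberField.RingOfIntegers.coe_eq_algebraMap]
      simp only [map_add, map_sub, map_mul, map_pow, map_neg, map_one, map_ofNat, hσ₅b, hσ₅x]
      linear_combination ((0 : ℝ)) * hσ₅r + ((0 : ℝ)) * hysqσ₅
    rw [hv]; linarith [hXXl₂, hXXu₂, hYXl₂, hYXu₂, hYXXl₂, hYXXu₂, hs2l, hs2u, hl₂, hu₂]
  have se₂σ₆ : σ₆ ((e₂ : 𝓞 ↥(ℚ⟮θ⟯ ⊔ (CyclotomicZp.zpExtension 2).layer 1)) : ↥(ℚ⟮θ⟯ ⊔ (CyclotomicZp.zpExtension 2).layer 1)) < 0 := by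
    have hv : σ₆ ((e₂ : 𝓞 ↥(ℚ⟮θ⟯ ⊔ (CyclotomicZp.zpExtension 2).layer 1)) : ↥(ℚ⟮θ⟯ ⊔ (CyclotomicZp.zpExtension 2).layer 1)) = (4 : ℝ) + (2 : ℝ) * Real.sqrt 2 + ((1 : ℝ) / 2) * (Real.sqrt 2 * x₂) + (-1 : ℝ) * (x₂ * x₂) + ((-1 : ℝ) / 2) * (Real.sqrt 2 * (x₂ * x₂)) := by
      rw [he₂def, Units.val_mkOfMulEqOne, NumberField.RingOfIntegers.coe_eq_algebraMap]
      simp only [map_add, map_sub, map_mul, map_pow, map_neg, map_one, map_ofNat, hσ₆b, hσ₆x]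
      linear_combination ((0 : ℝ)) * hσ₆r + ((0 : ℝ)) * hysqσ₆
    rw [hv]; linarith [hXXl₂, hXXu₂, hYXl₂, hYXu₂, hYXXl₂, hYXXu₂, hs2l, hs2u, hl₂, hu₂]
  have se₃σ₁ : 0 < σ₁ ((e₃ : 𝓞 ↥(ℚ⟮θ⟯ ⊔ (CyclotomicZp.zpExtension 2).layer 1)) : ↥(ℚ⟮θ⟯ ⊔ (CyclotomicZp.zpExtension 2).layer 1)) := by
    have hv : σ₁ ((e₃ : 𝓞 ↥(ℚ⟮θ⟯ ⊔ (CyclotomicZp.zpExtension 2).layer 1)) : ↥(ℚ⟮θ⟯ ⊔ (CyclotomicZp.zpExtension 2).layer 1)) = (1 : ℝ) * (-x₀) + ((1 : ℝ) / 2) * (Real.sqrt 2 * (-x₀)) + ((1 : ℝ) / 2) * (Real.sqrt 2 * ((-x₀) * (-x₀))) := by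
      rw [he₃def, Units.val_mkOfMulEqOne, NumberField.RingOfIntegers.coe_eq_algebraMap]
      simp only [map_add, map_sub, map_mul, map_pow, map_neg, map_one, map_ofNat, hσ₁b, hσ₁x]
      linear_combination ((-1 : ℝ) * (Real.sqrt 2)) * hσ₁r + ((0 : ℝ)) * hysqσ₁
    rw [hv]; linarith [hXXl₀, hXXu₀, hYXl₀, hYXu₀, hYXXl₀, hYXXu₀, hs2l, hs2u, hXl₀, hXu₀]
  have se₃σ₂ : σ₂ ((e₃ : 𝓞 ↥(ℚ⟮θ⟯ ⊔ (CyclotomicZp.zpExtension 2).layer 1)) : ↥(ℚ⟮θ⟯ ⊔ (CyclotomicZp.zpExtension 2).layer 1)) < 0 := by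
    have hv : σ₂ ((e₃ : 𝓞 ↥(ℚ⟮θ⟯ ⊔ (CyclotomicZp.zpExtension 2).layer 1)) : ↥(ℚ⟮θ⟯ ⊔ (CyclotomicZp.zpExtension 2).layer 1)) = (1 : ℝ) * (-x₀) + ((-1 : ℝ) / 2) * (Real.sqrt 2 * (-x₀)) + ((-1 : ℝ) / 2) * (Real.sqrt 2 * ((-x₀) * (-x₀))) := by
      rw [he₃def, Units.val_mkOfMulEqOne, NumberField.RingOfIntegers.coe_eq_algebraMap]
      simp only [map_add, map_sub, map_mul, map_pow, map_neg, map_one, map_ofNat, hσ₂b, hσ₂x]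
      linear_combination ((-1 : ℝ) * (-Real.sqrt 2)) * hσ₂r + ((0 : ℝ)) * hysqσ₂
    rw [hv]; linarith [hXXl₀, hXXu₀, hYXl₀, hYXu₀, hYXXl₀, hYXXu₀, hs2l, hs2u, hXl₀, hXu₀]
  have se₃σ₄ : σ₄ ((e₃ : 𝓞 ↥(ℚ⟮θ⟯ ⊔ (CyclotomicZp.zpExtension 2).layer 1)) : ↥(ℚ⟮θ⟯ ⊔ (CyclotomicZp.zpExtension 2).layer 1)) < 0 := by
    have hv : σ₄ ((e₃ : 𝓞 ↥(ℚ⟮θ⟯ ⊔ (CyclotomicZp.zpExtension 2).layer 1)) : ↥(ℚ⟮θ⟯ ⊔ (CyclotomicZp.zpExtension 2).layer 1)) = (-1 : ℝ) * x₁ + ((1 : ℝ) / 2) * (Real.sqrt 2 * x₁) + ((-1 : ℝ) / 2) * (Real.sqrt 2 * (x₁ * x₁)) := by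
      rw [he₃def, Units.val_mkOfMulEqOne, NumberField.RingOfIntegers.coe_eq_algebraMap]
      simp only [map_add, map_sub, map_mul, map_pow, map_neg, map_one, map_ofNat, hσ₄b, hσ₄x]
      linear_combination ((-1 : ℝ) * (-Real.sqrt 2)) * hσ₄r + ((0 : ℝ)) * hysqσ₄
    rw [hv]; linarith [hXXl₁, hXXu₁, hYXl₁, hYXu₁, hYXXl₁, hYXXu₁, hs2l, hs2u, hl₁, hu₁]
  have se₃σ₅ : σ₅ ((e₃ : 𝓞 ↥(ℚ⟮θ⟯ ⊔ (CyclotomicZp.zpExtension 2).layer 1)) : ↥(ℚ⟮θ⟯ ⊔ (CyclotomicZp.zpExtension 2).layer 1)) < 0 := by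
    have hv : σ₅ ((e₃ : 𝓞 ↥(ℚ⟮θ⟯ ⊔ (CyclotomicZp.zpExtension 2).layer 1)) : ↥(ℚ⟮θ⟯ ⊔ (CyclotomicZp.zpExtension 2).layer 1)) = (-1 : ℝ) * x₂ + ((-1 : ℝ) / 2) * (Real.sqrt 2 * x₂) + ((1 : ℝ) / 2) * (Real.sqrt 2 * (x₂ * x₂)) := by
      rw [he₃def, Units.val_mkOfMulEqOne, NumberField.RingOfIntegers.coe_eq_algebraMap]
      simp only [map_add, map_sub, map_mul, map_pow, map_neg, map_one, map_ofNat, hσ₅b, hσ₅x]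
      linear_combination ((-1 : ℝ) * (Real.sqrt 2)) * hσ₅r + ((0 : ℝ)) * hysqσ₅
    rw [hv]; linarith [hXXl₂, hXXu₂, hYXl₂, hYXu₂, hYXXl₂, hYXXu₂, hs2l, hs2u, hl₂, hu₂]
  have se₃σ₆ : σ₆ ((e₃ : 𝓞 ↥(ℚ⟮θ⟯ ⊔ (CyclotomicZp.zpExtension 2).layer 1)) : ↥(ℚ⟮θ⟯ ⊔ (CyclotomicZp.zpExtension 2).layer 1)) < 0 := by
    have hv : σ₆ ((e₃ : 𝓞 ↥(ℚ⟮θ⟯ ⊔ (CyclotomicZp.zpExtension 2).layer 1)) : ↥(ℚ⟮θ⟯ ⊔ (CyclotomicZp.zpExtension 2).layer 1)) = (-1 : ℝ) * x₂ + ((1 : ℝ) / 2) * (Real.sqrt 2 * x₂) + ((-1 : ℝ) / 2) * (Real.sqrt 2 * (x₂ * x₂)) := by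
      rw [he₃def, Units.val_mkOfMulEqOne, NumberField.RingOfIntegers.coe_eq_algebraMap]
      simp only [map_add, map_sub, map_mul, map_pow, map_neg, map_one, map_ofNat, hσ₆b, hσ₆x]
      linear_combination ((-1 : ℝ) * (-Real.sqrt 2)) * hσ₆r + ((0 : ℝ)) * hysqσ₆
    rw [hv]; linarith [hXXl₂, hXXu₂, hYXl₂, hYXu₂, hYXXl₂, hYXXu₂, hs2l, hs2u, hl₂, hu₂]
  have se₄σ₁ : 0 < σ₁ ((e₄ : 𝓞 ↥(ℚ⟮θ⟯ ⊔ (CyclotomicZp.zpExtension 2).layer 1)) : ↥(ℚ⟮θ⟯ ⊔ (CyclotomicZp.zpExtension 2).layer 1)) := by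
    have hv : σ₁ ((e₄ : 𝓞 ↥(ℚ⟮θ⟯ ⊔ (CyclotomicZp.zpExtension 2).layer 1)) : ↥(ℚ⟮θ⟯ ⊔ (CyclotomicZp.zpExtension 2).layer 1)) = (-1 : ℝ) * (-x₀) + ((1 : ℝ) / 2) * (Real.sqrt 2 * (-x₀)) + ((1 : ℝ) / 2) * (Real.sqrt 2 * ((-x₀) * (-x₀))) := by
      rw [he₄def, Units.val_mkOfMulEqOne, NumberField.RingOfIntegers.coe_eq_algebraMap]
      simp only [map_add, map_sub, map_mul, map_pow, map_neg, map_one, map_ofNat, hσ₁b, hσ₁x]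
      linear_combination ((-1 : ℝ) * (Real.sqrt 2)) * hσ₁r + ((0 : ℝ)) * hysqσ₁
    rw [hv]; linarith [hXXl₀, hXXu₀, hYXl₀, hYXu₀, hYXXl₀, hYXXu₀, hs2l, hs2u, hXl₀, hXu₀]
  have se₄σ₂ : σ₂ ((e₄ : 𝓞 ↥(ℚ⟮θ⟯ ⊔ (CyclotomicZp.zpExtension 2).layer 1)) : ↥(ℚ⟮θ⟯ ⊔ (CyclotomicZp.zpExtension 2).layer 1)) < 0 := by
    have hv : σ₂ ((e₄ : 𝓞 ↥(ℚ⟮θ⟯ ⊔ (CyclotomicZp.zpExtension 2).layer 1)) : ↥(ℚ⟮θ⟯ ⊔ (CyclotomicZp.zpExtension 2).layer 1)) = (-1 : ℝ) * (-x₀) + ((-1 : ℝ) / 2) * (Real.sqrt 2 * (-x₀)) + ((-1 : ℝ) / 2) * (Real.sqrt 2 * ((-x₀) * (-x₀))) := by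
      rw [he₄def, Units.val_mkOfMulEqOne, NumberField.RingOfIntegers.coe_eq_algebraMap]
      simp only [map_add, map_sub, map_mul, map_pow, map_neg, map_one, map_ofNat, hσ₂b, hσ₂x]
      linear_combination ((-1 : ℝ) * (-Real.sqrt 2)) * hσ₂r + ((0 : ℝ)) * hysqσ₂
    rw [hv]; linarith [hXXl₀, hXXu₀, hYXl₀, hYXu₀, hYXXl₀, hYXXu₀, hs2l, hs2u, hXl₀, hXu₀]
  have se₄σ₄ : 0 < σ₄ ((e₄ : 𝓞 ↥(ℚ⟮θ⟯ ⊔ (CyclotomicZp.zpExtension 2).layer 1)) : ↥(ℚ⟮θ⟯ ⊔ (CyclotomicZp.zpExtension 2).layer 1)) := by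
    have hv : σ₄ ((e₄ : 𝓞 ↥(ℚ⟮θ⟯ ⊔ (CyclotomicZp.zpExtension 2).layer 1)) : ↥(ℚ⟮θ⟯ ⊔ (CyclotomicZp.zpExtension 2).layer 1)) = (1 : ℝ) * x₁ + ((1 : ℝ) / 2) * (Real.sqrt 2 * x₁) + ((-1 : ℝ) / 2) * (Real.sqrt 2 * (x₁ * x₁)) := by
      rw [he₄def, Units.val_mkOfMulEqOne, NumberField.RingOfIntegers.coe_eq_algebraMap]
      simp only [map_add, map_sub, map_mul, map_pow, map_neg, map_one, map_ofNat, hσ₄b, hσ₄x]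
      linear_combination ((-1 : ℝ) * (-Real.sqrt 2)) * hσ₄r + ((0 : ℝ)) * hysqσ₄
    rw [hv]; linarith [hXXl₁, hXXu₁, hYXl₁, hYXu₁, hYXXl₁, hYXXu₁, hs2l, hs2u, hl₁, hu₁]
  have se₄σ₅ : 0 < σ₅ ((e₄ : 𝓞 ↥(ℚ⟮θ⟯ ⊔ (CyclotomicZp.zpExtension 2).layer 1)) : ↥(ℚ⟮θ⟯ ⊔ (CyclotomicZp.zpExtension 2).layer 1)) := by
    have hv : σ₅ ((e₄ : 𝓞 ↥(ℚ⟮θ⟯ ⊔ (CyclotomicZp.zpExtension 2).layer 1)) : ↥(ℚ⟮θ⟯ ⊔ (CyclotomicZp.zpExtension 2).layer 1)) = (1 : ℝ) * x₂ + ((-1 : ℝ) / 2) * (Real.sqrt 2 * x₂) + ((1 : ℝ) / 2) * (Real.sqrt 2 * (x₂ * x₂)) := by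
      rw [he₄def, Units.val_mkOfMulEqOne, NumberField.RingOfIntegers.coe_eq_algebraMap]
      simp only [map_add, map_sub, map_mul, map_pow, map_neg, map_one, map_ofNat, hσ₅b, hσ₅x]
      linear_combination ((-1 : ℝ) * (Real.sqrt 2)) * hσ₅r + ((0 : ℝ)) * hysqσ₅
    rw [hv]; linarith [hXXl₂, hXXu₂, hYXl₂, hYXu₂, hYXXl₂, hYXXu₂, hs2l, hs2u, hl₂, hu₂]
  have se₄σ₆ : 0 < σ₆ ((e₄ : 𝓞 ↥(ℚ⟮θ⟯ ⊔ (CyclotomicZp.zpExtension 2).layer 1)) : ↥(ℚ⟮θ⟯ ⊔ (CyclotomicZp.zpExtension 2).layer 1)) := by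
    have hv : σ₆ ((e₄ : 𝓞 ↥(ℚ⟮θ⟯ ⊔ (CyclotomicZp.zpExtension 2).layer 1)) : ↥(ℚ⟮θ⟯ ⊔ (CyclotomicZp.zpExtension 2).layer 1)) = (1 : ℝ) * x₂ + ((1 : ℝ) / 2) * (Real.sqrt 2 * x₂) + ((-1 : ℝ) / 2) * (Real.sqrt 2 * (x₂ * x₂)) := by
      rw [he₄def, Units.val_mkOfMulEqOne, NumberField.RingOfIntegers.coe_eq_algebraMap]
      simp only [map_add, map_sub, map_mul, map_pow, map_neg, map_one, map_ofNat, hσ₆b, hσ₆x]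
      linear_combination ((-1 : ℝ) * (-Real.sqrt 2)) * hσ₆r + ((0 : ℝ)) * hysqσ₆
    rw [hv]; linarith [hXXl₂, hXXu₂, hYXl₂, hYXu₂, hYXXl₂, hYXXu₂, hs2l, hs2u, hl₂, hu₂]
  -- the sign matrix of `-1, e₁, e₂, e₃, e₄` at `σ₁, σ₂, σ₄, σ₅, σ₆`
  have hs : ∀ i j, signVec (![e₀, e₁, e₂, e₃, e₄] i) (![σ₁, σ₂, σ₄, σ₅, σ₆] j) = !![(1 : ZMod 2), 1, 1, 1, 1; 0, 1, 1, 0, 1; 0, 1, 0, 1, 1; 0, 1, 1, 1, 1; 0, 1, 0, 0, 0] i j := by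
    intro i j
    fin_cases i <;> fin_cases j
    · show signVec (-1) σ₁ = 1; rw [signVec_neg_one]
    · show signVec (-1) σ₂ = 1; rw [signVec_neg_one]
    · show signVec (-1) σ₄ = 1; rw [signVec_neg_one]
    · show signVec (-1) σ₅ = 1; rw [signVec_neg_one]
    · show signVec (-1) σ₆ = 1; rw [signVec_neg_one]
    · show signVec e₁ σ₁ = 0; exact spos σ₁ e₁ se₁σ₁
    · show signVec e₁ σ₂ = 1; exact sneg σ₂ e₁ se₁σ₂
    · show signVec e₁ σ₄ = 1; exact sneg σ₄ e₁ se₁σ₄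
    · show signVec e₁ σ₅ = 0; exact spos σ₅ e₁ se₁σ₅
    · show signVec e₁ σ₆ = 1; exact sneg σ₆ e₁ se₁σ₆
    · show signVec e₂ σ₁ = 0; exact spos σ₁ e₂ se₂σ₁
    · show signVec e₂ σ₂ = 1; exact sneg σ₂ e₂ se₂σ₂
    · show signVec e₂ σ₄ = 0; exact spos σ₄ e₂ se₂σ₄
    · show signVec e₂ σ₅ = 1; exact sneg σ₅ e₂ se₂σ₅
    · show signVec e₂ σ₆ = 1; exact sneg σ₆ e₂ se₂σ₆
    · show signVec e₃ σ₁ = 0; exact spos σ₁ e₃ se₃σ₁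
    · show signVec e₃ σ₂ = 1; exact sneg σ₂ e₃ se₃σ₂
    · show signVec e₃ σ₄ = 1; exact sneg σ₄ e₃ se₃σ₄
    · show signVec e₃ σ₅ = 1; exact sneg σ₅ e₃ se₃σ₅
    · show signVec e₃ σ₆ = 1; exact sneg σ₆ e₃ se₃σ₆
    · show signVec e₄ σ₁ = 0; exact spos σ₁ e₄ se₄σ₁
    · show signVec e₄ σ₂ = 1; exact sneg σ₂ e₄ se₄σ₂
    · show signVec e₄ σ₄ = 0; exact spos σ₄ e₄ se₄σ₄
    · show signVec e₄ σ₅ = 0; exact spos σ₅ e₄ se₄σ₅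
    · show signVec e₄ σ₆ = 0; exact spos σ₆ e₄ se₄σ₆
  have hdet : IsUnit (!![(1 : ZMod 2), 1, 1, 1, 1; 0, 1, 1, 0, 1; 0, 1, 0, 1, 1; 0, 1, 1, 1, 1; 0, 1, 0, 0, 0]) := by
    haveI := invertibleOfRightInverse !![(1 : ZMod 2), 1, 1, 1, 1; 0, 1, 1, 0, 1; 0, 1, 0, 1, 1; 0, 1, 1, 1, 1; 0, 1, 0, 0, 0] !![(1 : ZMod 2), 0, 0, 1, 0; 0, 0, 0, 0, 1; 0, 0, 1, 1, 0; 0, 1, 0, 1, 0; 0, 1, 1, 1, 1] (by decide)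
    exact isUnit_of_invertible _

  have hsig := two_pow_le_card_range_signVec ![e₀, e₁, e₂, e₃, e₄] ![σ₁, σ₂, σ₄, σ₅, σ₆] _ hs hdet
  exact card_totPosUnitsModSq_eq_two_of_bounds (n := 5) hfinA hsig (two_le_card_totPosUnitsModSq_adjoin_sup_layer_one_d316 hθ)

/-- **`[Cl⁺(A₁) : Cl⁺(A₁)²] = 2` for `A₁ = ℚ(θ) ⊔ ℚ_1`, `θ³ − θ² − 4θ + 2 = 0`** (`rank₂ Cl⁺(ℚ(θ,√2)) = 1`): `h(A₁)` odd and `#(U⁺/U²)(A₁) = 2`.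
KERNEL — layer `1` of the narrow rank certificate of the census row `261648q1`. [cite: FrohlichTaylor1990, Ch. V §1 (1.8)–(1.13), pp. 163–164]
[cite: Fukuda1994, Thm. 1 (2), p. 264] -/
theorem index_range_pow_two_narrowClassGroup_adjoin_sup_layer_one_d316
    (hθ : aeval θ (Cubic.toPoly ⟨1, ((-1 : ℤ) : ℚ), ((-4 : ℤ) : ℚ), ((2 : ℤ) : ℚ)⟩) = 0) :
    haveI : FiniteDimensional ℚ ↥ℚ⟮θ⟯ :=
      IntermediateField.adjoin.finiteDimensional ⟨_, Cubic.monic_of_a_eq_one', by rwa [← aeval_def]⟩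
    haveI : FiniteDimensional ℚ ↥((CyclotomicZp.zpExtension 2).layer 1) := (CyclotomicZp.zpExtension 2).finiteDimensional_layer_holds 1
    haveI : NumberField ↥(ℚ⟮θ⟯ ⊔ (CyclotomicZp.zpExtension 2).layer 1) := NumberField.mk
    (powMonoidHom (α := NarrowClassGroup ↥(ℚ⟮θ⟯ ⊔ (CyclotomicZp.zpExtension 2).layer 1)) 2).range.index = 2 := by
  haveI : FiniteDimensional ℚ ↥ℚ⟮θ⟯ :=
    IntermediateField.adjoin.finiteDimensional ⟨_, Cubic.monic_of_a_eq_one', by rwa [← aeval_def]⟩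
  haveI : FiniteDimensional ℚ ↥((CyclotomicZp.zpExtension 2).layer 1) := (CyclotomicZp.zpExtension 2).finiteDimensional_layer_holds 1
  haveI : NumberField ↥(ℚ⟮θ⟯ ⊔ (CyclotomicZp.zpExtension 2).layer 1) := NumberField.mk
  obtain ⟨hreal, -, -⟩ := layer_one_basics_d316 hθ
  haveI := hreal
  rw [index_range_pow_two_narrowClassGroup_eq_card_totPosUnitsModSq_of_odd_classNumber (odd_classNumber_adjoin_sup_layer_one_d316 hθ),
    card_totPosUnitsModSq_adjoin_sup_layer_one_d316 hθ]

end Summit.BirchSwinnertonDyer.BirchSwinnertonDyer.Theorems.AddKatoTwo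

end
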